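import Mathlib.Analysis.SpecialFunctions.Pow.Real
import Mathlib.Analysis.SpecialFunctions.Sqrt

/-!
# EriceRemainderEnclosureHistoryAutonomyComparisonGreedyChain — (E65c) THE GREEDY CERTIFICATE AND ITS μ-CHAIN: for ANY finite age set `A ⊆ ℕ_{≥1}` and loads
# `x ≥ 0`, the GREEDY youngest-first weights `π_k(1 + x_k∕4) = 1 − Σ_{j∈A, j<k} x_j(k∕(k+j))²π_j` are a certificate of (E64e)'s slack system (dual
# feasibility is automatic; cost `Σ x_kπ_k ≤ 1`) as soon as a ONE-DIMENSIONAL CHAIN closes along the ages in increasing order: `μ_{m₀}(1 − 3x_{m₀}∕4) ≥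
# 3x_{m₀}∕4` at the youngest age and, at every other age `k` with predecessor `k⁻` in `A`, `a_k = 4k⁻k∕(k+k⁻)²`, **`x_k(a_kμ_{k⁻} + 3∕4) < 1`** and
# `μ_k(1 − x_k(3∕4 + a_kμ_{k⁻})) ≥ a_kμ_{k⁻}(1 + x_k) + 3x_k∕4`.  Mathlib only.  Plugged into (E65b)'s budgeted criterion it reduces conjecture (E58′) to
# «the window budget closes the chain» — numerically `max_k x_k(a_kμ_{k⁻} + 3∕4) ≤ 0.59 < 1` over every budgeted load vector searched (README)

Cell `pub-balaban`, β-function sub-cell, BINDER row D4 «RemainderConst leaves for Bałaban's split» (`HOME/BINDER-OWNERS.md`; owner lineage `b2b-balaban-beta-an4`;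
this file by co-owner #2 lineage `b2b-balaban-beta-d4-p2`, generation 58), β-FLOW TEAM duty (1), FREEZE (0) honoured (def-free; Mathlib only).  Companion of
(E64b)∕(E64f) `…ComparisonSlackSystem(Sharp)` (oldest-first primal bookkeeping for towers) and (E65b) `…ComparisonBudgetedCriterion` (the socket).

HONEST FRAMING (page 1, verbatim and binding).  *"Discharging BetaPertH makes Bałaban's UV stability UNCONDITIONAL — a real constructive-QFT result; it is
NOT the continuum limit and NOT the Clay problem."*  THIS FILE DISCHARGES NOTHING OF THE KIND.  A lemma about finitely many non-negative reals; its use is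
through (E65b), whose hypotheses are those of a census, not facts; nothing of Bałaban's is asserted.  Row D4 class UNCHANGED (critical-path width 0; instance
0∕1; D4 DISCHARGE NO DATE).  HONEST DEPENDENCY: continuum YM on T⁴ ⇐ BetaPertH ∧ nine spine estimates (0/9 proved); BetaPertH ⇐ (D1) ∧ (D4) ∧ CAP+tail;
G-an2-4 gates asym, D1 and NE2/3/4.

THE POINT (census sense (α); the COMPARISON column, conjecture (E58′), route (C)).  By weak duality ((E64e) `sum_le_of_certificate`) ANY `π ≥ 0` with
`π_{k′} + Σ_j x_jG_{k′j}π_j ≥ 1` (`G_{k′j} = (k′∕(k′+j))²`, large for YOUNG `j`) and `Σ_j x_jπ_j ≤ 1` certifies the STEP.  The GREEDY choice processes the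
ages from the youngest up and saturates each row using only the younger weights already fixed; older columns only add, so feasibility is free, and the
cost is `1 − D` with `D` the final «dual slack».  Writing `c_k = x_kπ_k`, `D = 1 − Σ c`, `E_k = Σ_{j<k}(1 − G_{kj})c_j` (the DEFECT: how far the older row
is from re-reading the younger consumptions fully), one has `c_k = q_k(D + E_k)`, `q = x∕(1+x∕4)`, and the only danger is `E_k`.  Two facts tame it: (i)
the defect of an OLDER row against a fixed young column is smaller, by at least the factor `a = 4k⁻k∕(k+k⁻)² ≤ 1` when passing from the predecessor `k⁻`
to `k` (§1 `defect_ratio_le`: `1 − (k∕(k+s))² ≤ a·(1 − (k⁻∕(k⁻+s))²)` for `s ≤ k⁻`) — so the potential `Ψ_k = Σ_{j≤k}(1 − G_{kj})c_j` obeys `E_k ≤ a_kΨ_{k⁻}`;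
(ii) `Ψ_k = E_k + (3∕4)c_k`.  Hence the invariant `Ψ_k ≤ μ_k·D_k` propagates along the chain of the statement, and `D ≥ 0` as long as `q_k(1 + a_kμ_{k⁻}) ≤
1`, i.e. `x_k(a_kμ_{k⁻} + 3∕4) < 1` (§2).  Numerically (README `chain2.py`), with `μ` taken minimal, the window budget of (E65a) keeps `x_k(a_kμ_{k⁻} + 3∕4)
≤ 0.59` on towers of every ratio, dense runs `1..20`, mixed and random sets (the maximiser is usually ONE loaded age: `3x∕4 ≤ 0.53`); proving «budget ⟹ chain»
would settle (E58′) for every finite profile.  NOT CLAIMED: that implication; anything printed.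

WHAT IS PROVED ([folklore]; 0 `def`, 0 sorry; Mathlib only).  §1 `one_sub_sq_div_eq`, **`defect_ratio_le`**.  §2 **`certificate_of_chain`**.
-/
noncomputable section
open Finset

namespace Summit.QuantumFields.BalabanUV.Beta.EriceRemainderEnclosureHistoryAutonomyComparisonGreedyChain

/-! ## §1 The defect of an older row is smaller -/

/-- `1 − (w∕(w+s))² = s(2w+s)∕(w+s)²` for `w + s ≠ 0`. [folklore] -/
theorem one_sub_sq_div_eq {w s : ℝ} (h : w + s ≠ 0) : 1 - (w / (w + s)) ^ 2 = s * (2 * w + s) / (w + s) ^ 2 := by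
  field_simp
  ring

/-- **THE DEFECT OF AN OLDER ROW IS SMALLER**: for `0 ≤ s ≤ v`, `0 < v ≤ w`: `1 − (w∕(w+s))² ≤ (4vw∕(w+v)²)·(1 − (v∕(v+s))²)` — from
`(2w+s)∕(2v+s) ≤ w∕v` and `(v+s)∕(w+s) ≤ 2v∕(w+v)`; the factor `4vw∕(w+v)² ≤ 1` is `≈ 4v∕w` for `w ≫ v` (the sharp factor is `(4∕3)(1 − (w∕(w+v))²)`).
[folklore] -/
theorem defect_ratio_le {s v w : ℝ} (hs : 0 ≤ s) (hsv : s ≤ v) (hv : 0 < v) (hvw : v ≤ w) :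
    1 - (w / (w + s)) ^ 2 ≤ 4 * v * w / (w + v) ^ 2 * (1 - (v / (v + s)) ^ 2) := by
  have hw : 0 < w := hv.trans_le hvw
  rw [one_sub_sq_div_eq (by positivity : w + s ≠ 0), one_sub_sq_div_eq (by positivity : v + s ≠ 0)]
  rw [show 4 * v * w / (w + v) ^ 2 * (s * (2 * v + s) / (v + s) ^ 2) = 4 * v * w * (s * (2 * v + s)) / ((w + v) ^ 2 * (v + s) ^ 2) by
    field_simp]
  rw [div_le_div_iff₀ (by positivity) (by positivity)]
  have hA : (2 * w + s) * v ≤ (2 * v + s) * w := by nlinarith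
  have hB : (v + s) * (w + v) ≤ 2 * v * (w + s) := by nlinarith
  have hB2 : ((v + s) * (w + v)) ^ 2 ≤ (2 * v * (w + s)) ^ 2 := pow_le_pow_left₀ (by positivity) hB 2
  have h1 : 0 ≤ s * (2 * w + s) := by positivity
  have h2 : 0 ≤ 4 * v * s * (w + s) ^ 2 := by positivity
  calc s * (2 * w + s) * ((w + v) ^ 2 * (v + s) ^ 2) = s * (2 * w + s) * ((v + s) * (w + v)) ^ 2 := by ring
    _ ≤ s * (2 * w + s) * (2 * v * (w + s)) ^ 2 := mul_le_mul_of_nonneg_left hB2 h1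
    _ = 4 * v * s * (w + s) ^ 2 * ((2 * w + s) * v) := by ring
    _ ≤ 4 * v * s * (w + s) ^ 2 * ((2 * v + s) * w) := mul_le_mul_of_nonneg_left hA h2
    _ = 4 * v * w * (s * (2 * v + s)) * (w + s) ^ 2 := by ring

/-! ## §2 The greedy certificate under the μ-chain -/

/-- **THE GREEDY CERTIFICATE UNDER THE μ-CHAIN.**  `A` a finite set of ages `≥ 1` with minimum `m₀` and predecessor map `pred` (`pred k` = the largest
element of `A` below `k`, for `k ≠ m₀`); loads `x ≥ 0` and chain values `μ ≥ 0` on `A` with, writing `a_k = 4·pred k·k∕(k + pred k)²`: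
`3x_{m₀}∕4 < 1`, `μ_{m₀}(1 − 3x_{m₀}∕4) ≥ 3x_{m₀}∕4`, and for every `k ≠ m₀` in `A`: **`x_k(a_kμ_{pred k} + 3∕4) < 1`** and
`μ_k(1 − x_k(3∕4 + a_kμ_{pred k})) ≥ a_kμ_{pred k}(1 + x_k) + 3x_k∕4`.  Then there is `π ≥ 0` on `A` with `π_{k′} + Σ_{j∈A} x_j(k′∕(k′+j))²π_j ≥ 1` for every
`k′ ∈ A` and `Σ_{j∈A} x_jπ_j ≤ 1` — a certificate for (E64e)∕(E65b).  (The greedy weights; induction on `A` from the youngest age up with the invariants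
`π ≥ 0`, feasibility, `D = 1 − Σ xπ ≥ 0`, `Σ_j(1 − G_{max,j})x_jπ_j ≤ μ_{max}·D`.) [folklore] -/
theorem certificate_of_chain {A : Finset ℕ} {x μ : ℕ → ℝ} {pred : ℕ → ℕ} {m₀ : ℕ}
    (hA1 : ∀ k ∈ A, 1 ≤ k) (hx : ∀ k ∈ A, 0 ≤ x k) (hm₀ : m₀ ∈ A) (hmin : ∀ k ∈ A, m₀ ≤ k)
    (hpred : ∀ k ∈ A, k ≠ m₀ → pred k ∈ A ∧ pred k < k ∧ ∀ k'' ∈ A, k'' < k → k'' ≤ pred k)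
    (hμ : ∀ k ∈ A, 0 ≤ μ k) (hx₀ : 3 / 4 * x m₀ < 1) (hμ₀ : 3 / 4 * x m₀ ≤ μ m₀ * (1 - 3 / 4 * x m₀))
    (hcond : ∀ k ∈ A, k ≠ m₀ → x k * (4 * (pred k : ℝ) * k / ((k : ℝ) + pred k) ^ 2 * μ (pred k) + 3 / 4) < 1)
    (hrec : ∀ k ∈ A, k ≠ m₀ → 4 * (pred k : ℝ) * k / ((k : ℝ) + pred k) ^ 2 * μ (pred k) * (1 + x k) + 3 / 4 * x k ≤
        μ k * (1 - x k * (3 / 4 + 4 * (pred k : ℝ) * k / ((k : ℝ) + pred k) ^ 2 * μ (pred k)))) :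
    ∃ π : ℕ → ℝ, (∀ k ∈ A, 0 ≤ π k) ∧
      (∀ k' ∈ A, 1 ≤ π k' + ∑ j ∈ A, x j * ((k' : ℝ) / ((k' : ℝ) + j)) ^ 2 * π j) ∧ ∑ j ∈ A, x j * π j ≤ 1 := by
  classical
  -- the diagonal coupling is 1/4
  have hdiag : ∀ k : ℕ, 1 ≤ k → ((k : ℝ) / ((k : ℝ) + k)) ^ 2 = 1 / 4 := by
    intro k hk
    have hkr : (0 : ℝ) < k := by exact_mod_cast hk
    rw [show (k : ℝ) / ((k : ℝ) + k) = 1 / 2 by field_simp; ring]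
    norm_num
  -- the main claim over initial segments S of A
  have key : ∀ S : Finset ℕ, S ⊆ A → (∀ k ∈ S, ∀ k'' ∈ A, k'' < k → k'' ∈ S) →
      ∃ π : ℕ → ℝ, (∀ k ∈ S, 0 ≤ π k) ∧
        (∀ k' ∈ S, 1 ≤ π k' + ∑ j ∈ S, x j * ((k' : ℝ) / ((k' : ℝ) + j)) ^ 2 * π j) ∧
        0 ≤ 1 - ∑ j ∈ S, x j * π j ∧
        (∀ hS : S.Nonempty, ∑ j ∈ S, (1 - ((S.max' hS : ℝ) / ((S.max' hS : ℝ) + j)) ^ 2) * (x j * π j) ≤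
          μ (S.max' hS) * (1 - ∑ j ∈ S, x j * π j)) := by
    intro S
    induction S using Finset.induction_on_max with
    | empty =>
      intro _ _
      exact ⟨fun _ => 0, fun _ h => absurd h (notMem_empty _), fun _ h => absurd h (notMem_empty _), by simp,
        fun hS => absurd hS Finset.not_nonempty_empty⟩
    | insert M s hlt ih =>
      intro hsub hinit
      have hMs : M ∉ s := fun h => lt_irrefl _ (hlt M h)
      have hMA : M ∈ A := hsub (mem_insert_self M s)
      have hM1 : 1 ≤ M := hA1 M hMA
      have hMr : (0 : ℝ) < M := by exact_mod_cast hM1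
      have hsA : s ⊆ A := fun k hk => hsub (mem_insert_of_mem hk)
      have hsinit : ∀ k ∈ s, ∀ k'' ∈ A, k'' < k → k'' ∈ s := by
        intro k hk k'' hk'' hlt'
        have h1 := hinit k (mem_insert_of_mem hk) k'' hk'' hlt'
        rcases mem_insert.mp h1 with h2 | h2
        · exact absurd (h2 ▸ hlt' : M < k) (not_lt.mpr (hlt k hk).le)
        · exact h2
      obtain ⟨π, hπ0, hfeas, hD, hΨ⟩ := ih hsA hsinit
      have hxM := hx M hMA
      have hμM := hμ M hMA
      have hx4 : 0 < 1 + x M / 4 := by linarith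
      -- the slack D, the defect E of row M, the new weight v
      obtain ⟨D, hD_def⟩ : ∃ D : ℝ, D = 1 - ∑ j ∈ s, x j * π j := ⟨_, rfl⟩
      obtain ⟨E, hE_def⟩ : ∃ E : ℝ, E = ∑ j ∈ s, (1 - ((M : ℝ) / ((M : ℝ) + j)) ^ 2) * (x j * π j) := ⟨_, rfl⟩
      have hD0 : 0 ≤ D := by rw [hD_def]; exact hD
      have hN : ∑ j ∈ s, x j * ((M : ℝ) / ((M : ℝ) + j)) ^ 2 * π j = (1 - D) - E := by
        rw [hD_def, hE_def, sub_sub_cancel, ← sum_sub_distrib]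
        exact sum_congr rfl fun j _ => by ring
      have hE0 : 0 ≤ E := by
        rw [hE_def]
        refine sum_nonneg fun j hj => ?_
        have hj0 : (0 : ℝ) ≤ j := Nat.cast_nonneg j
        have hG1 : ((M : ℝ) / ((M : ℝ) + j)) ^ 2 ≤ 1 := by
          rw [div_pow, div_le_one (by positivity)]; nlinarith
        exact mul_nonneg (by linarith) (mul_nonneg (hx j (hsA hj)) (hπ0 j hj))
      obtain ⟨v, hv_def⟩ : ∃ v : ℝ, v = (D + E) / (1 + x M / 4) := ⟨_, rfl⟩
      have hv0 : 0 ≤ v := by rw [hv_def]; exact div_nonneg (by linarith) hx4.le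
      have hvN : v * (1 + x M / 4) = D + E := by rw [hv_def]; field_simp
      have hcN : x M * v * (1 + x M / 4) = x M * (D + E) := by rw [mul_assoc, hvN]
      obtain ⟨π', hπ'_def⟩ : ∃ π' : ℕ → ℝ, π' = fun k => if k = M then v else π k := ⟨_, rfl⟩
      have hπ'M : π' M = v := by rw [hπ'_def]; simp
      have hπ's : ∀ j ∈ s, π' j = π j := fun j hj => by
        have : j ≠ M := fun h => hMs (h ▸ hj)
        rw [hπ'_def]; simp [this]
      -- sums over insert M s
      have hsum1 : ∑ j ∈ insert M s, x j * π' j = x M * v + ∑ j ∈ s, x j * π j := by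
        rw [sum_insert hMs, hπ'M]
        congr 1; exact sum_congr rfl fun j hj => by rw [hπ's j hj]
      have hsumG : ∀ k' : ℕ, ∑ j ∈ insert M s, x j * ((k' : ℝ) / ((k' : ℝ) + j)) ^ 2 * π' j =
          x M * ((k' : ℝ) / ((k' : ℝ) + M)) ^ 2 * v + ∑ j ∈ s, x j * ((k' : ℝ) / ((k' : ℝ) + j)) ^ 2 * π j := by
        intro k'
        rw [sum_insert hMs, hπ'M]
        congr 1; exact sum_congr rfl fun j hj => by rw [hπ's j hj]
      have hsumΨ : ∑ j ∈ insert M s, (1 - ((M : ℝ) / ((M : ℝ) + j)) ^ 2) * (x j * π' j) = 3 / 4 * (x M * v) + E := by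
        rw [sum_insert hMs, hπ'M, hdiag _ hM1, hE_def]
        have hrest : ∑ j ∈ s, (1 - ((M : ℝ) / ((M : ℝ) + j)) ^ 2) * (x j * π' j) =
            ∑ j ∈ s, (1 - ((M : ℝ) / ((M : ℝ) + j)) ^ 2) * (x j * π j) := sum_congr rfl fun j hj => by rw [hπ's j hj]
        rw [hrest]; ring
      have hmax : ∀ hS : (insert M s).Nonempty, (insert M s).max' hS = M := fun hS => by
        apply le_antisymm
        · exact max'_le _ hS _ fun k hk => by
            rcases mem_insert.mp hk with hkM | hk
            · exact hkM.le
            · exact (hlt k hk).le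
        · exact le_max' _ _ (mem_insert_self M s)
      -- (I1) and (I2) are common to both cases
      have hI1 : ∀ k ∈ insert M s, 0 ≤ π' k := by
        intro k hk
        rcases mem_insert.mp hk with hkM | hk
        · rw [hkM, hπ'M]; exact hv0
        · rw [hπ's k hk]; exact hπ0 k hk
      have hI2 : ∀ k' ∈ insert M s, 1 ≤ π' k' + ∑ j ∈ insert M s, x j * ((k' : ℝ) / ((k' : ℝ) + j)) ^ 2 * π' j := by
        intro k' hk'
        rw [hsumG]
        rcases mem_insert.mp hk' with hkM | hk'
        · rw [hkM, hπ'M, hdiag _ hM1, hN]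
          have : x M * (1 / 4) * v = v * (1 + x M / 4) - v := by ring
          rw [this, hvN]; linarith
        · rw [hπ's k' hk']
          have h1 := hfeas k' hk'
          have h2 : 0 ≤ x M * ((k' : ℝ) / ((k' : ℝ) + M)) ^ 2 * v := by positivity
          linarith
      -- the two remaining invariants: a bound c ≤ D on the consumption c = x_M v and the potential bound
      suffices hI34 : x M * v ≤ D ∧ 3 / 4 * (x M * v) + E ≤ μ M * (D - x M * v) by
        refine ⟨π', hI1, hI2, ?_, fun hS => ?_⟩
        · rw [hsum1, hD_def] at *; linarith [hI34.1]
        · rw [hmax hS, hsumΨ, hsum1, show 1 - (x M * v + ∑ j ∈ s, x j * π j) = D - x M * v by rw [hD_def]; ring]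
          exact hI34.2
      rcases s.eq_empty_or_nonempty with hs | hs
      · -- base: s = ∅, so M = m₀, D = 1, E = 0
        have hD1 : D = 1 := by rw [hD_def, hs, sum_empty, sub_zero]
        have hE1 : E = 0 := by rw [hE_def, hs, sum_empty]
        have hMm : M = m₀ := by
          by_contra hne
          have hlt' : m₀ < M := lt_of_le_of_ne (hmin M hMA) (Ne.symm hne)
          have h1 := hinit M (mem_insert_self M s) m₀ hm₀ hlt'
          rw [hs, mem_insert] at h1
          rcases h1 with h1 | h1
          · exact absurd h1 (ne_of_lt hlt')
          · simp at h1
        rw [hD1, hE1] at hcN ⊢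
        rw [hMm] at hcN hμM hxM hx4 ⊢
        -- c(1 + x/4) = x: c = q; (i) q ≤ 1; (ii) (3/4) q ≤ μ (1 − q) from μ(1 − 3x/4) ≥ 3x/4
        have hc : x m₀ * v * (1 + x m₀ / 4) = x m₀ := by rw [hcN]; ring
        constructor
        · have h1 : x m₀ * v * (1 + x m₀ / 4) ≤ 1 * (1 + x m₀ / 4) := by rw [hc]; linarith [hx₀]
          exact le_of_mul_le_mul_right h1 hx4
        · -- multiply the goal by (1 + x/4) > 0
          have hgoal : (3 / 4 * (x m₀ * v) + 0) * (1 + x m₀ / 4) ≤ (μ m₀ * (1 - x m₀ * v)) * (1 + x m₀ / 4) := by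
            have e1 : (3 / 4 * (x m₀ * v) + 0) * (1 + x m₀ / 4) = 3 / 4 * (x m₀ * v * (1 + x m₀ / 4)) := by ring
            have e2 : (μ m₀ * (1 - x m₀ * v)) * (1 + x m₀ / 4) = μ m₀ * (1 + x m₀ / 4) - μ m₀ * (x m₀ * v * (1 + x m₀ / 4)) := by
              ring
            rw [e1, e2, hc]
            have e3 : μ m₀ * (1 + x m₀ / 4) - μ m₀ * x m₀ = μ m₀ * (1 - 3 / 4 * x m₀) := by ring
            rw [e3]; exact hμ₀
          exact le_of_mul_le_mul_right hgoal hx4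
      · -- step: s nonempty, its maximum M' is the predecessor of M in A
        obtain ⟨M', hM'_def⟩ : ∃ M' : ℕ, M' = s.max' hs := ⟨_, rfl⟩
        have hM's : M' ∈ s := hM'_def ▸ max'_mem s hs
        have hM'A : M' ∈ A := hsA hM's
        have hM'M : M' < M := hlt M' hM's
        have hne : M ≠ m₀ := fun h => by
          have := hmin M' hM'A; rw [← h] at this; exact absurd hM'M (not_lt.mpr this)
        obtain ⟨hpA, hplt, hpmax⟩ := hpred M hMA hne
        have hpeq : pred M = M' := by
          apply le_antisymm
          · have h1 := hinit M (mem_insert_self M s) (pred M) hpA hplt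
            rcases mem_insert.mp h1 with h2 | h2
            · exact absurd h2 (ne_of_lt hplt)
            · rw [hM'_def]; exact le_max' s _ h2
          · exact hpmax M' hM'A hM'M
        have hM'1 : 1 ≤ M' := hA1 M' hM'A
        have hM'r : (0 : ℝ) < M' := by exact_mod_cast hM'1
        obtain ⟨a, ha_def⟩ : ∃ a : ℝ, a = 4 * (M' : ℝ) * M / ((M : ℝ) + M') ^ 2 := ⟨_, rfl⟩
        have ha0 : 0 ≤ a := by rw [ha_def]; positivity
        have hc := hcond M hMA hne
        have hr := hrec M hMA hne
        rw [hpeq, ← ha_def] at hc hr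
        have hΨ' := hΨ hs
        rw [← hM'_def] at hΨ'
        have hμM' := hμ M' hM'A
        -- E ≤ a·Ψ(s) ≤ a·μ_{M'}·D
        have hEΨ : E ≤ a * ∑ j ∈ s, (1 - ((M' : ℝ) / ((M' : ℝ) + j)) ^ 2) * (x j * π j) := by
          rw [hE_def, mul_sum]
          refine sum_le_sum fun j hj => ?_
          have hj1 : (1 : ℝ) ≤ j := by exact_mod_cast hA1 j (hsA hj)
          have hjM' : (j : ℝ) ≤ M' := by rw [hM'_def]; exact_mod_cast le_max' s j hj
          have hdr := defect_ratio_le (s := (j : ℝ)) (v := (M' : ℝ)) (w := (M : ℝ)) (by linarith) hjM' hM'r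
            (by exact_mod_cast hM'M.le)
          have hxp : 0 ≤ x j * π j := mul_nonneg (hx j (hsA hj)) (hπ0 j hj)
          calc (1 - ((M : ℝ) / ((M : ℝ) + j)) ^ 2) * (x j * π j)
              ≤ 4 * (M' : ℝ) * M / ((M : ℝ) + M') ^ 2 * (1 - ((M' : ℝ) / ((M' : ℝ) + j)) ^ 2) * (x j * π j) :=
                mul_le_mul_of_nonneg_right hdr hxp
            _ = a * ((1 - ((M' : ℝ) / ((M' : ℝ) + j)) ^ 2) * (x j * π j)) := by rw [ha_def]; ring
        have hEμ : E ≤ a * μ M' * D := by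
          have h1 := mul_le_mul_of_nonneg_left hΨ' ha0
          rw [← hD_def] at h1
          calc E ≤ _ := hEΨ
            _ ≤ a * (μ M' * D) := h1
            _ = a * μ M' * D := by ring
        have haμ : 0 ≤ a * μ M' := mul_nonneg ha0 hμM'
        constructor
        · -- (I3): c(1 + x/4) = x(D + E) ≤ x D (1 + a μ') ≤ D (1 + x/4)
          have h0 : D + E ≤ D + a * μ M' * D := by linarith [hEμ]
          have h1 : x M * (D + E) ≤ x M * D * (1 + a * μ M') :=
            calc x M * (D + E) ≤ x M * (D + a * μ M' * D) := mul_le_mul_of_nonneg_left h0 hxM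
              _ = x M * D * (1 + a * μ M') := by ring
          have h2 : x M * (1 + a * μ M') ≤ 1 + x M / 4 := by
            have e : x M * (1 + a * μ M') = x M * (a * μ M' + 3 / 4) + x M / 4 := by ring
            rw [e]; linarith [hc]
          have h3 : x M * D * (1 + a * μ M') ≤ D * (1 + x M / 4) :=
            calc x M * D * (1 + a * μ M') = D * (x M * (1 + a * μ M')) := by ring
              _ ≤ D * (1 + x M / 4) := mul_le_mul_of_nonneg_left h2 hD0
          have h4 : x M * v * (1 + x M / 4) ≤ D * (1 + x M / 4) := by rw [hcN]; exact h1.trans h3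
          exact le_of_mul_le_mul_right h4 hx4
        · -- (I4): E(1 + x + μ x) ≤ D(μ(1 − 3x/4) − 3x/4), then clear (1 + x/4)
          have hr' : a * μ M' * (1 + x M) + a * μ M' * μ M * x M ≤ μ M * (1 - 3 / 4 * x M) - 3 / 4 * x M := by
            have e : μ M * (1 - x M * (3 / 4 + a * μ M')) = μ M * (1 - 3 / 4 * x M) - a * μ M' * μ M * x M := by ring
            rw [e] at hr; linarith
          have hkey : E * (1 + x M + μ M * x M) ≤ D * (μ M * (1 - 3 / 4 * x M) - 3 / 4 * x M) := by
            have h1 : E * (1 + x M + μ M * x M) ≤ a * μ M' * D * (1 + x M + μ M * x M) :=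
              mul_le_mul_of_nonneg_right hEμ (by positivity)
            have h2 : a * μ M' * D * (1 + x M + μ M * x M) = D * (a * μ M' * (1 + x M) + a * μ M' * μ M * x M) := by ring
            rw [h2] at h1
            exact h1.trans (mul_le_mul_of_nonneg_left hr' hD0)
          have hgoal : (3 / 4 * (x M * v) + E) * (1 + x M / 4) ≤ (μ M * (D - x M * v)) * (1 + x M / 4) := by
            have e1 : (3 / 4 * (x M * v) + E) * (1 + x M / 4) = 3 / 4 * (x M * v * (1 + x M / 4)) + E * (1 + x M / 4) := by
              ring
            have e2 : (μ M * (D - x M * v)) * (1 + x M / 4) = μ M * (D * (1 + x M / 4) - x M * v * (1 + x M / 4)) := by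
              ring
            rw [e1, e2, hcN]
            calc 3 / 4 * (x M * (D + E)) + E * (1 + x M / 4)
                = E * (1 + x M + μ M * x M) + (3 / 4 * x M * D - μ M * x M * E) := by ring
              _ ≤ D * (μ M * (1 - 3 / 4 * x M) - 3 / 4 * x M) + (3 / 4 * x M * D - μ M * x M * E) :=
                  add_le_add hkey le_rfl
              _ = μ M * (D * (1 + x M / 4) - x M * (D + E)) := by ring
          exact le_of_mul_le_mul_right hgoal hx4
  obtain ⟨π, hπ0, hfeas, hD, _⟩ := key A Subset.rfl (fun _ _ k'' hk'' _ => hk'')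
  exact ⟨π, hπ0, hfeas, by linarith⟩

end Summit.QuantumFields.BalabanUV.Beta.EriceRemainderEnclosureHistoryAutonomyComparisonGreedyChain

end
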